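import Literature.NumberTheory.LFunctions.WeilPositivityCertificate
import HarnessLib

/-!
# Two-prime minorant cells on `[0, 80]`: materialized partial moment sums, part 12

Exact values of the partial sums `Σ_{j ∈ chunk} momentQ_j(q)` of the 248 two-prime cells over the four kernel-sized chunks (`C0`, `C1.take 53`, `C1.drop 53`, `C2`), even `q`; each value is verified by the kernel in the sibling fact files and consumed by `WeilCert23.checkNuAt_of_partsT80`. Generated by exact arithmetic (lead c5, crux stmt-RiemannHypothesis-1526). [cite: Yoshida1992, §6]
-/

noncomputable section

namespace Literature.NumberTheory.LFunctions

/-- Partial cell sum `Σ_{j ∈ chunk 2} momentQ_j(314)` of the two-prime minorant on `[0, 80]` (exact value). [folklore] -/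
def nuPartT80_2_314 : ℚ := (-20234463153449036648400776925968514184180965188822279968023798881130138147247723543731544490101767430738226067863182946229614294897715731047159257541045164417916931048433467652869477854144335473336763134195821273188232614795180506772445551033195918107825610702886530757687338506633298721944481625838982712880215120355107498981748051552514303789600965977757548368591582491496067969830346802016959693851348912206400077574559019306883166853025932530722743422682230132363122547037915029981706810869106511544271660084170345653743302360042537369213154696667023385937851279871104793388983608395195263784873242896786433015184389334081630694374959527812949063178913310893534647079587389199737590905741510020166228537494380337974230180351628547048570043513203055531644676795379624322602087556834598015848542947808165741153352974098067780505979566279960427409542641452588361433406778644695105046571499413862342982563244498736062853145802150087700668378732757983823157506520442029980856953069442029460793122122691727700128079518443276063593939064604749609263711714166160247519076806223377489786392138799954623304799030054503739421136494114317714995086799692913812152195792232458147535286356483887638770486274254694209/3582501323300637415799121936231914311264969710737635093291120114647920311963523579550900287649787331045096777093527208743876652389103425995437296920727301803437340319615290175391340775628162212326714004036001834697721627953002174076573317785962107015319565122512781419048741740313823369698595197740840132270453095285005813884077147430642532061140238391527364540662664944144181384664930576153774603058169665517810692823597088444836001516024269989487305421070635914835252778535285029165088278532824137827083156226157328277402653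4172858182257217091118083193753172414088853642824077374770581613451766116715956928572913581018147291877622057908823860769904146976853721088000)

/-- Partial cell sum `Σ_{j ∈ chunk 3} momentQ_j(314)` of the two-prime minorant on `[0, 80]` (exact value). [folklore] -/
def nuPartT80_3_314 : ℚ := (-5257188230840368320567313324620963249291982748511586787393144527355921677133895205483288508137236214634932483994156775931107395742137399612031941462809198663454150446760087925851502261636133502552439895922848056474624626909478548473507547160720482921534676043840281619387522821310950991533935112994993513131356405829012672671263777415169268532384362359236152916547551787370764313213963973115394785891220262668887346208216459783003202933610018270708319121394838995342845564100799224114880912082999616813173445571893618308617285336093906293748402405529294080942733370820935342724645802524949587052898356930636769811527368093421485304781086695390040033625365903908107536937907795170548412305660248409282873152218807123446431671567995171184636960665185005206843385527389917014016442316380518949665931559506671095846375604312667252977350771462778183860396629997357616826560481426397106801667117445068955528691426612174293008584190260917556200955997869865565136929799631039674988007676623782065403865297913195517077809818965845705085507423006460905692545510780351479771588691226139914691498013907857351474802488860099970290063970556072809239446719352459103307953005338482100160320373224777349510921234301258227994071109787908547331899077470441430242604612511547700768366502260245084351688557924186727824069865611/6869303940193299402535047197177325557254209659120876577994834904239358827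228460948270772595613827304450693800346738881496370635963313579150558109555485371394247655276175223943486363066380956238536741041671116783884569994248996567763277059877498938437954848030214199361546769505539998109176385944115673036134356667282090894303483268988323971622864071702056659494061861282714470011637215995123852545067503157497354403361271495249159807067047534534579254184473032657329842412452612057069683165052418435952712888605987330535943618931858147287293916771634005226703042858861165997917999209848600610498776180231556776952155193288928849168697006164181904355000151737085745319458485952182418348207717773573852495872000)

end Literature.NumberTheory.LFunctions
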